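import Summits.QuantumFields.YangMills.Theorems.BalabanUVNodesN12FlatDatumRigidityNested
import Summits.QuantumFields.YangMills.Theorems.BalabanUVNodesN12Thm1RowAtFlatDatum
import Summits.QuantumFields.YangMills.Theorems.BalabanUVNodesN11Thm2PointCountAtRecord13CoPH
import Summits.QuantumFields.YangMills.Theorems.BalabanUVNodesN07RecordDomainsCollar
import Literature.MathematicalPhysics.QuantumFieldTheory.Balaban1983to89.B15Prop1Thm1LetterLengthZero
import Literature.MathematicalPhysics.QuantumFieldTheory.Balaban1983to89.B15Claim189UnitTestAtRecord
import Literature.MathematicalPhysics.QuantumFieldTheory.Balaban1983to89.B11Thm1ExistsUniqueCoP7MG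
import HarnessLib

/-!
# BalabanUVNodes ∕ N12 — THE BODY OF THE (E∕U) NAMED FACT `VariationalThm1EUSepTop7M(G)` ([Balaban1985Variational] Thm 1, existence ∕ uniqueness) HOLDS AT THE FLAT DATUM `W = M˙(1)`
# FOR EVERY SEPARATED (2.18) INDEX in the budgeted length range `k + 1 ≤ m + K` — the torus class and the class of record alike (non-vacuity of the lane's ✓p740853 ∕ ✓p742279 over
# their whole index range; dag-n12-w1's LOCATED-3 «tower-site graph plausibly connected» settled for every separated index)

[Balaban1985Variational] = «[15]», Thm 1 p. 279, (1) p. 277, (2)–(4), (6)–(7) p. 278; [Balaban1988Convergent] = «[III]», (2.1)–(2.2) pp. 254–255, (2.10)–(2.13) pp. 256–257, (2.18) p. 257;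
[Balaban1985RegularSpaces] (1.3)–(1.9) p. 77; [Balaban1987RG1] (0.1)–(0.4) pp. 251–253.

Cell `pub-ymgap` (HUMAN RULINGS D-0062 ∕ D-0149), lane `pub-ymgap-dag-n12-c` g30 (R134 seat (a), N12 = [B15], s1, LANE OWNER; key K1⁹ `stmt-QuantumFields-27364`,
`--kind proof --supports …`; count-neutral).  THEOREMS ONLY (0 `def`, 0 `instance`, 0 `sorry`).  Consumed BY NAME: this lane's `…N12FlatDatumRigidityNested` (rigidity under the displayed
hypotheses (N)(B)(S)), dag-n12-w6 g17's `…N12Thm1RowAtFlatDatum` (`holFlat_of_wilsonAction4_le_one`, `segments_of_agreeOn_one`, `letterBudget_atRecord`), dag-n11's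
`…N11Thm2PointCountAtRecord13CoPH.isBlockUnion_of_mem_unionsOfCubes` (members of def-R's cube classes are unions of blocks, BY NAME), dag-n07-w3's `…N07RecordDomainsCollar.mem_enlT_of_distSite_iterBlockOf_le_one` (adjacent blocks lie within
one cube layer), dag-n12-e's `B15Claim189PinNonVacuity.isMinimizer_one_avgFamily_one` and `B15Claim189UnitTestAtRecord.avgFamily_avOfRecord_one`, this lane's g29
`B15Prop1Thm1LetterLengthZero.mem_class_of_flat`, r11's `B14Eq218Concrete.Seq` ∕ `Chain21`, NODE 00's `SeqOfRecord`, `Sect2.SeqSeparated`, `unionsOfCubes`.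

WHAT.  §1 discharges the hypotheses (N)(B)(S) of `…N12FlatDatumRigidityNested` for r11's (2.18) indices `s : Seq D k` over ANY class `D` of unions of def-R cubes whose side at scale `j` is a
multiple of `Lʲ` (dag-n11's `isBlockUnion_of_mem_unionsOfCubes`, by name), with NODE 00's separation `Sect2.SeqSeparated M₁ s`, `M₁ ≥ 1` (`sep_of_seqSeparated`).  §2 ★★★ `thm1EU_clause_at_flatDatum_of_seq`:
for such an index (`1 ≤ k`, `k + 1 ≤ m + K`), ANY reading class `reg ∋ 1` and the FLAT datum `M˙(1)` — (E) `1` is a (2.12) minimiser, and (U) ANY two (2.12) minimisers `U₁, U₂` are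
related `U₁^u = U₂` by a gauge transformation with EQUAL and CENTRAL scale-`j` images at the two ends of every constrained bond (`A(U_i) ≤ A(1) = 0` ⇒ holonomy-flat ⇒ trivial straight
transporters on the constrained bonds ⇒ rigidity).  §3 the two index classes of the lane's letters: ★★★ `thm1TorusClassEU_body_at_flatDatum` (the torus class `unionsOfCubes (side L M₁ n)`
of `B15Prop1Thm1RowsOfExistsUniquePos`'s `h15EUT⁺`) and ★★★ `variationalThm1EUSepTop7MG_body_at_flatDatum` (NODE 00's `SeqOfRecord F ν M g K k` — the index range of
`B11Thm1ExistsUniqueCoP7M(G).VariationalThm1EUSepTop7M(G)`, any top-domain selector `Sup`, any guard, any `ε₀ > 0`): at `W := M˙(1) = 1` the CONCLUSION of the named fact holds.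

WHY.  The lane's g30 audit of its own (E∕U) name (cell bus «AUDIT-CLEAN», HOME memo `N12-H15EU-ORPHAN-2026-08-29.md` §5): at the flat datum the tower-central clause fails iff the tower-site
constraint graph is disconnected (dag-n12-w1 g4 `…N12Thm1CentralLetterTwistObstruction`); dag-n12-w6 g17 certified the clause for the RECORD's `𝐁_k(Z)`; the name quantifies ALL separated
indices.  This file closes the gap: for every separated index of either class the clause (and (E)) hold at `M˙(1)` — so neither name is refutable by the twist family, at any admissible
index, and w1's LOCATED-3 is settled in general (connectivity is what the rigidity theorem's `u = 1 at every tower site` expresses).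

HONEST FRAMING ∕ NOT CLAIMED.  An A2-type NON-VACUITY certificate for ONE datum (the flat one) of two displayed NAMED facts that remain WITHOUT producer ([15] Props 2–9, N07 ∕ NODE-00);
nothing of Bałaban's estimates asserted or refuted; the budget row `k + 1 ≤ m + K` is DISPLAYED (lengths beyond the lattice range are not read); count-neutral helper; N12 NOT discharged; K0⁷ ∕
K1⁹ NOT closed; counts of record unmoved; one finite 𝕋⁴ programme at fixed ε — R4 closes the conditional rung `BalabanLadder.UV` only; the Yang–Mills mass gap (Clay) is NOT proved by any of
this; nothing continuum ∕ ℝ⁴ ∕ OS.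
-/

namespace Summit.QuantumFields.YangMills.BalabanUVNodes.N12Thm1EUAtFlatDatumAllIndices

open Set
open Literature.MathematicalPhysics.QuantumFieldTheory.Balaban1983to89
open Literature.MathematicalPhysics.QuantumFieldTheory.Balaban1983to89.Node00
open B15DeterminingSets (DetSet pts mem_pts bondsOf embIter genSet AgreeOn avgFamily IsMinimizer MSField spliceAt)
open B14.Eq22Determines (IsBlockUnion)
open B14.Eq213MaximalDomains (side)
open B5Eq118OneStroke (iterBlockOf)
open B5Prop12FieldsLattice (distSite distSite_self)
open B5RowSumsP12Lattice (distSite_comm)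
open B5Eq117TorusCarriers (Mk)
open B16Sect1Backgrounds (toMS)
open T4Continuum (T4Family walk walkEnd holAt netDisp Letter)
open GaugeField (gaugeAct)
open Summit.QuantumFields.YangMills.BalabanUVNodes.N12FlatDatumRigidityNested (exists_towerCentral_gauge_of_flat_segments_genSet)
open Summit.QuantumFields.YangMills.BalabanUVNodes.N12Thm1RowAtFlatDatum (holFlat_of_wilsonAction4_le_one segments_of_agreeOn_one letterBudget_atRecord plaqSmallOn_one)
open Summit.QuantumFields.YangMills.Theorems.BalabanUVNodesN11Thm2PointCountAtRecord13CoPH (isBlockUnion_of_mem_unionsOfCubes)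
open Summit.QuantumFields.YangMills.BalabanUVNodes.N07RecordDomainsCollar (mem_enlT_of_distSite_iterBlockOf_le_one)
open Summit.QuantumFields.YangMills.BalabanUVNodes.N12FlatHndRecordLetters (blockIter_eq_iterBlockOf)
open Summit.QuantumFields.YangMills.BalabanUVNodes.N12TowerSiteGraphConnectedBjPrelim (blockIter_shift_or)
open Summit.QuantumFields.YangMills.Theorems.FlatCubeQContraction (distSite_shift_le_one)
open B15Claim189PinNonVacuity (isMinimizer_one_avgFamily_one)
open B15Claim189UnitTestAtRecord (avgFamily_avOfRecord_one iter_avOfRecord_one)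
open B15Prop1Thm1LetterLengthZero (mem_class_of_flat)

/-! ## §1  The hypotheses (N)(B)(S) for r11's (2.18) indices over classes of unions of aligned cubes, with NODE 00's separation -/

section Discharge

variable {P : Params}

/-- **(B) along a (2.18) index**: every `Ω_j(s)`, `1 ≤ j ≤ k ≤ m + K`, is a union of `j`-blocks when the class `D j` consists of unions of cubes of side a multiple of `Lʲ`.
[cite: Balaban1988Convergent, (2.1) p.254, (2.18) p.257] -/
theorem isBlockUnion_seq {D : ℕ → Set (Set (Site P 0))} {σ : ℕ → ℕ} (hD : ∀ j, D j ⊆ unionsOfCubes P (σ j)) (hσ : ∀ j, P.L ^ j ∣ σ j)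
    {k : ℕ} (hk : k ≤ P.m + P.K) (s : B14.Eq218Concrete.Seq D k) :
    ∀ j, 1 ≤ j → j ≤ k → IsBlockUnion j (s.Ω j) := fun j h1 hj =>
  isBlockUnion_of_mem_unionsOfCubes (hj.trans hk) (hσ j) (hD j (s.chain.memΩ j h1 hj))

/-- **(S) from NODE 00's separation** `Sect2.SeqSeparated M₁` (one layer of `L^{j+1}M₁`-cubes around `Ω_{j+1}` inside `Ω_j`, `M₁ ≥ 1`): a fine site adjacent to `Ω_{j+1}` has its whole
`(j+1)`-block in `Ω_j` — the `(j+1)`-blocks of adjacent sites are within sup-distance `1`, so every block-mate lies within one cube layer of `Ω_{j+1}` (dag-n07-w3's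
`mem_enlT_of_distSite_iterBlockOf_le_one`). [cite: Balaban1985RegularSpaces, (1.3)–(1.6) p.77; Balaban1988Convergent, (2.1) p.254, p.256] -/
theorem sep_of_seqSeparated {M₁ : ℕ} (hM₁ : 1 ≤ M₁) {k : ℕ} (hk : k ≤ P.m + P.K) {Ω : ℕ → Set (Site P 0)}
    (hsepT : ∀ j, 1 ≤ j → j < k → Sect2.enlT P (side P.L M₁ (j + 1)) 1 (Ω (j + 1)) ⊆ Ω j) :
    ∀ j, 1 ≤ j → j + 1 ≤ k → ∀ (x z : Site P 0) (μ : Fin P.d), (z = x.shift μ ∨ x = z.shift μ) → z ∈ Ω (j + 1) →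
      ∀ y : Site P 0, B14.Eq22Determines.blockIter (j + 1) y = B14.Eq22Determines.blockIter (j + 1) x → y ∈ Ω j := by
  intro j hj1 hjk x z μ hadj hz y hy
  have hjK : j + 1 ≤ P.m + P.K := by omega
  have hd : distSite (Mk P (j + 1)) (iterBlockOf (j + 1) z) (iterBlockOf (j + 1) y) ≤ 1 := by
    rw [← blockIter_eq_iterBlockOf, ← blockIter_eq_iterBlockOf, hy]
    rcases hadj with rfl | rfl
    · rcases blockIter_shift_or hjK x μ with e | e
      · rw [e, distSite_self]; norm_num
      · rw [e, distSite_comm]; exact distSite_shift_le_one _ μ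
    · rcases blockIter_shift_or hjK z μ with e | e
      · rw [e, distSite_self]; norm_num
      · rw [e]; exact distSite_shift_le_one _ μ
  exact hsepT j hj1 (by omega) (mem_enlT_of_distSite_iterBlockOf_le_one hjK hM₁ hz hd)

end Discharge

/-! ## §2  The (E∕U) clause at the flat datum for every separated cube-class index -/

section Clause

variable {F : T4Family} {N : ℕ} [NeZero N] {Kt : ℕ}

/-- ★★★ **[15] THM 1's EXISTENCE ∕ UNIQUENESS CLAUSE AT THE FLAT DATUM, FOR EVERY SEPARATED (2.18) INDEX OVER A CLASS OF ALIGNED CUBE UNIONS.**  For `1 ≤ k`, `k + 1 ≤ m + K`, a class `D`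
of unions of def-R cubes with `Lʲ ∣ side_j`, an index `s : Seq D k` separated for some `M₁ ≥ 1`, and ANY reading class `reg ∋ 1`: (E) `1` is a (2.12) minimiser for the datum `M˙(1)` on
`genSet s.Ω k`; (U) any two (2.12) minimisers for that datum are related `U₁^u = U₂` with `toMS u j` EQUAL and CENTRAL (indeed `= 1`) at the two tower sites of every constrained bond.
[cite: Balaban1985Variational, Thm 1 p.279, (3)–(4) p.278; Balaban1988Convergent, (2.2) p.255, (2.10)–(2.13) pp.256–257, (2.18) p.257; Balaban1985RegularSpaces, (1.3)–(1.6) p.77] -/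
theorem thm1EU_clause_at_flatDatum_of_seq {D : ℕ → Set (Set (Site (F.P Kt) 0))} {σ : ℕ → ℕ}
    (hD : ∀ j, D j ⊆ unionsOfCubes (F.P Kt) (σ j)) (hσ : ∀ j, (F.P Kt).L ^ j ∣ σ j)
    {k : ℕ} (hk1 : 1 ≤ k) (hkK : k + 1 ≤ (F.P Kt).m + (F.P Kt).K) {M₁ : ℕ} (hM₁ : 1 ≤ M₁)
    (s : B14.Eq218Concrete.Seq D k) (hsep : Sect2.SeqSeparated M₁ s)
    (reg : Set (GaugeField (F.P Kt) 0 (SU N))) (h1 : (1 : GaugeField (F.P Kt) 0 (SU N)) ∈ reg) :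
    IsMinimizer (avOfRecord F N Kt) reg (genSet s.Ω k) (avgFamily (avOfRecord F N Kt) 1) 1 ∧
      ∀ U₁ U₂ : GaugeField (F.P Kt) 0 (SU N),
        IsMinimizer (avOfRecord F N Kt) reg (genSet s.Ω k) (avgFamily (avOfRecord F N Kt) 1) U₁ →
        IsMinimizer (avOfRecord F N Kt) reg (genSet s.Ω k) (avgFamily (avOfRecord F N Kt) 1) U₂ →
        ∃ u : GaugeTransf (F.P Kt) 0 (SU N),
          (∀ j, j ≤ k → ∀ b ∈ bondsOf (genSet s.Ω k j), toMS u j b.src = toMS u j b.tgt ∧ ∀ g : SU N, toMS u j b.src * g = g * toMS u j b.src) ∧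
            gaugeAct u U₁ = U₂ := by
  have hk : k ≤ (F.P Kt).m + (F.P Kt).K := by omega
  refine ⟨isMinimizer_one_avgFamily_one _ h1 _, fun U₁ U₂ hU₁ hU₂ => ?_⟩
  -- both minimisers are holonomy-flat with trivial straight transporters on the constrained bonds
  have hone : IsMinimizer (avOfRecord F N Kt) reg (genSet s.Ω k) (avgFamily (avOfRecord F N Kt) 1) 1 := isMinimizer_one_avgFamily_one _ h1 _
  have hflat₁ := holFlat_of_wilsonAction4_le_one U₁ (hU₁.2.2 1 hone.1 hone.2.1)
  have hflat₂ := holFlat_of_wilsonAction4_le_one U₂ (hU₂.2.2 1 hone.1 hone.2.1)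
  have hseg₁ := segments_of_agreeOn_one (genSet s.Ω k) U₁ hflat₁ hU₁.2.1
  have hseg₂ := segments_of_agreeOn_one (genSet s.Ω k) U₂ hflat₂ hU₂.2.1
  exact exists_towerCentral_gauge_of_flat_segments_genSet hk1 hk (fun j h1' hj => s.chain.Ω_succ_subset_Ω h1' hj)
    (isBlockUnion_seq hD hσ hk s) (sep_of_seqSeparated hM₁ hk hsep) (letterBudget_atRecord hkK) U₁ U₂
    hflat₁ (fun j _ c hc => hseg₁ j c hc) hflat₂ (fun j _ c hc => hseg₂ j c hc)

end Clause

/-! ## §3  The two index classes of the lane's letters: the torus class (`h15EUT⁺`) and the class of record (`VariationalThm1EUSepTop7M(G)`) -/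

section Letters

variable {F : T4Family} {N : ℕ} [NeZero N]

/-- `Lʲ ∣ LʲM₁ = side L M₁ j`. [cite: Balaban1988Convergent, (2.13) p.256 (bookkeeping)] -/
theorem pow_dvd_side (L M₁ j : ℕ) : L ^ j ∣ side L M₁ j := ⟨M₁, rfl⟩

/-- `Lʲ ∣ Lʲ·M·R_j = dCubeSide L M R_j j`. [cite: Balaban1988Convergent, (2.1) p.254 (bookkeeping)] -/
theorem pow_dvd_dCubeSide (L M Rj j : ℕ) : L ^ j ∣ dCubeSide L M Rj j := ⟨M * Rj, by unfold dCubeSide; ring⟩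

/-- ★★★ **THE TORUS-CLASS LETTER `h15EUT⁺`'s CONCLUSION AT THE FLAT DATUM, EVERY SEPARATED INDEX** (`B15Prop1Thm1RowsOfExistsUniquePos` §2's letter: indices
`s : Seq (unionsOfCubes (side L M₁ n)) k'`, `0 < k'`, separated, `0 < M₁`; its class literal at any `ε₀ > 0` and any top domain `Ω₀`): with `W := M˙(1)` the conclusion «(∃ minimiser) ∧ (any two
minimisers are tower-centrally gauge related)» HOLDS, for every budgeted length `k' + 1 ≤ m + K`.  Non-vacuity of the letter at one datum over its full index range.
[cite: Balaban1985Variational, Thm 1 p.279, (2)–(4), (6) p.278; Balaban1988Convergent, (2.2) p.255, (2.12)–(2.13) pp.256–257, (2.18) p.257; Balaban1985RegularSpaces, (1.3)–(1.9) p.77] -/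
theorem thm1TorusClassEU_body_at_flatDatum (ν : Stage7Numerics) (Kt : ℕ) (hM : 0 < ν.M₁) {k' : ℕ} (hk0 : 0 < k') (hkK : k' + 1 ≤ (F.P Kt).m + (F.P Kt).K)
    (s : B14.Eq218Concrete.Seq (fun n : ℕ => unionsOfCubes (F.P Kt) (side (F.P Kt).L ν.M₁ n)) k') (hsep : Sect2.SeqSeparated ν.M₁ s)
    (Ω₀ : Set (Site (F.P Kt) 0)) {ε₀ : ℝ} (hε₀ : 0 < ε₀) :
    (∃ U₀ : GaugeField (F.P Kt) 0 (SU N), IsMinimizer (avOfRecord F N Kt)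
        {U | (∀ j, j ≤ k' → PlaqSmallOn (Sect2.omegaPlaqsTop s.Ω Ω₀ j) (ε₀ * (F.P Kt).eta j ^ 2) U) ∧ Sect2.CoDivClassOnTop s.Ω Ω₀ k' ε₀ U}
        (genSet s.Ω k') (avgFamily (avOfRecord F N Kt) 1) U₀) ∧
    ∀ U₁ U₂ : GaugeField (F.P Kt) 0 (SU N),
      IsMinimizer (avOfRecord F N Kt)
        {U | (∀ j, j ≤ k' → PlaqSmallOn (Sect2.omegaPlaqsTop s.Ω Ω₀ j) (ε₀ * (F.P Kt).eta j ^ 2) U) ∧ Sect2.CoDivClassOnTop s.Ω Ω₀ k' ε₀ U}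
        (genSet s.Ω k') (avgFamily (avOfRecord F N Kt) 1) U₁ →
      IsMinimizer (avOfRecord F N Kt)
        {U | (∀ j, j ≤ k' → PlaqSmallOn (Sect2.omegaPlaqsTop s.Ω Ω₀ j) (ε₀ * (F.P Kt).eta j ^ 2) U) ∧ Sect2.CoDivClassOnTop s.Ω Ω₀ k' ε₀ U}
        (genSet s.Ω k') (avgFamily (avOfRecord F N Kt) 1) U₂ →
      ∃ u : GaugeTransf (F.P Kt) 0 (SU N),
        (∀ j, j ≤ k' → ∀ b ∈ bondsOf (genSet s.Ω k' j), toMS u j b.src = toMS u j b.tgt ∧ ∀ g : SU N, toMS u j b.src * g = g * toMS u j b.src) ∧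
          gaugeAct u U₁ = U₂ := by
  have h1 := mem_class_of_flat (U := (1 : GaugeField (F.P Kt) 0 (SU N))) (fun p => by simp [GaugeField.plaqHol]) s.Ω Ω₀ k' hε₀
  obtain ⟨hE, hU⟩ := thm1EU_clause_at_flatDatum_of_seq (F := F) (N := N) (Kt := Kt) (D := fun n : ℕ => unionsOfCubes (F.P Kt) (side (F.P Kt).L ν.M₁ n))
    (σ := fun n => side (F.P Kt).L ν.M₁ n) (fun _ => subset_rfl) (fun j => pow_dvd_side _ _ j) hk0 hkK hM s hsep _ h1
  exact ⟨⟨1, hE⟩, hU⟩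

/-- ★★★ **THE BODY OF `B11Thm1ExistsUniqueCoP7MG.VariationalThm1EUSepTop7MG` (hence of ✓p740853's floor-free `…Top7M` ∕ `…CoP7M` and of ✓p742279's guarded `…CoP7MG`) AT THE FLAT DATUM, EVERY
INDEX OF RECORD**: for every numerics `ν` with `0 < ν.M₁`, cube letter `M`, history `g`, torus `K`, budgeted length `0 < k`, `k + 1 ≤ m + K`, separated index `s : SeqOfRecord F ν M g K k`, any
selector `Sup` and any `ε₀ > 0`, at `W := M˙(1)` the fact's CONCLUSION holds: a minimiser over the class (6) at `ε₀` exists (`U₀ := 1`) and any two minimisers are tower-centrally gauge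
related.  The classes `𝐃_j` of record have side `LʲMR_j`, a multiple of `Lʲ`. [cite: Balaban1985Variational, Thm 1 p.279, (1) p.277, (2)–(4), (6) p.278; Balaban1988Convergent, (2.1) p.254, (2.2) p.255, (2.12) p.256, (2.18) p.257; Balaban1985RegularSpaces, (1.3)–(1.9) p.77] -/
theorem variationalThm1EUSepTop7MG_body_at_flatDatum (Sup : (ν : Stage7Numerics) → (K : ℕ) → (ℕ → Set (Site (F.P K) 0)) → Set (Site (F.P K) 0))
    (ν : Stage7Numerics) (M : ℕ) (g : ℕ → ℝ) (K k : ℕ) (s : SeqOfRecord F ν M g K k) (hk0 : 0 < k) (hkK : k + 1 ≤ (F.P K).m + (F.P K).K)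
    (hsep : Sect2.SeqSeparated ν.M₁ s) (hM : 0 < ν.M₁) {ε₀ : ℝ} (hε₀ : 0 < ε₀) :
    (∃ U₀ : GaugeField (F.P K) 0 (SU N), IsMinimizer (avOfRecord F N K)
        {U | (∀ n, n ≤ k → PlaqSmallOn (Sect2.omegaPlaqsTop s.Ω (Sup ν K s.Ω) n) (ε₀ * (F.P K).eta n ^ 2) U) ∧
          Sect2.CoDivClassOnTop s.Ω (Sup ν K s.Ω) k ε₀ U} (genSet s.Ω k) (avgFamily (avOfRecord F N K) 1) U₀) ∧
    ∀ U₁ U₂ : GaugeField (F.P K) 0 (SU N),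
      IsMinimizer (avOfRecord F N K)
          {U | (∀ n, n ≤ k → PlaqSmallOn (Sect2.omegaPlaqsTop s.Ω (Sup ν K s.Ω) n) (ε₀ * (F.P K).eta n ^ 2) U) ∧
            Sect2.CoDivClassOnTop s.Ω (Sup ν K s.Ω) k ε₀ U} (genSet s.Ω k) (avgFamily (avOfRecord F N K) 1) U₁ →
      IsMinimizer (avOfRecord F N K)
          {U | (∀ n, n ≤ k → PlaqSmallOn (Sect2.omegaPlaqsTop s.Ω (Sup ν K s.Ω) n) (ε₀ * (F.P K).eta n ^ 2) U) ∧
            Sect2.CoDivClassOnTop s.Ω (Sup ν K s.Ω) k ε₀ U} (genSet s.Ω k) (avgFamily (avOfRecord F N K) 1) U₂ →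
      ∃ u : GaugeTransf (F.P K) 0 (SU N),
        (∀ n, n ≤ k → ∀ b ∈ bondsOf (genSet s.Ω k n), toMS u n b.src = toMS u n b.tgt ∧ ∀ g : SU N, toMS u n b.src * g = g * toMS u n b.src) ∧
          gaugeAct u U₁ = U₂ := by
  have h1 := mem_class_of_flat (U := (1 : GaugeField (F.P K) 0 (SU N))) (fun p => by simp [GaugeField.plaqHol]) s.Ω (Sup ν K s.Ω) k hε₀
  obtain ⟨hE, hU⟩ := thm1EU_clause_at_flatDatum_of_seq (F := F) (N := N) (Kt := K) (D := DOfRecord F ν M g K)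
    (σ := fun j => dCubeSide (F.P K).L M (RkOfRecord (F.P K).L ν.r (g j)) j) (fun _ => subset_rfl) (fun j => pow_dvd_dCubeSide _ _ _ j) hk0 hkK hM s hsep _ h1
  exact ⟨⟨1, hE⟩, hU⟩

/-- ★ **THE FLAT DATUM IS WITHIN THE FACT's RANGE**: `M˙(1) = 1` (dag-n12-e's `avgFamily_avOfRecord_one`), so print's (7) `Sect2.DataSmall7PTop … δ (M˙1)` holds for every `δ > 0` (all its
plaquette fields are flat).  Hence the instance of §3 lies inside the antecedents of the named fact whenever the numerics `0 < δ_n ≤ a₁`, `B₃δ_n ≤ ε₀ ≤ a₀` are met (e.g. `0 < a₀, a₁`).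
[cite: Balaban1985Variational, (3),(7) p.278; Balaban1988Convergent, (2.10)–(2.12) p.256] -/
theorem dataSmall7PTop_flatDatum (K : ℕ) (Ω : ℕ → Set (Site (F.P K) 0)) (Ω₀ : Set (Site (F.P K) 0)) (k : ℕ) {δ : ℕ → ℝ} (hδ : ∀ n, n ≤ k → 0 < δ n) :
    Sect2.DataSmall7PTop (avOfRecord F N K) Ω Ω₀ k δ (avgFamily (avOfRecord F N K) 1) := by
  rw [avgFamily_avOfRecord_one]
  refine ⟨plaqSmallOn_one (hδ 0 (Nat.zero_le _)), fun m hm => ?_⟩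
  have h' : (avOfRecord F N K m).avg (Averaging.iter (avOfRecord F N K) m (1 : GaugeField (F.P K) 0 (SU N))) = 1 := iter_avOfRecord_one F N K (m + 1)
  rw [iter_avOfRecord_one F N K m] at h'
  have hmix : Sect2.mixedField (avOfRecord F N K) (genSet Ω k (m + 1)) ((1 : MSField (F.P K) (SU N)) (m + 1)) ((1 : MSField (F.P K) (SU N)) m) = 1 := by
    rw [Sect2.mixedField_eq_spliceAt, Pi.one_apply, Pi.one_apply, h']
    funext b
    exact ite_self _
  rw [hmix]
  exact plaqSmallOn_one (hδ (m + 1) hm)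

end Letters

end Summit.QuantumFields.YangMills.BalabanUVNodes.N12Thm1EUAtFlatDatumAllIndices
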